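import Summits.SmoothPoincare4.SmoothPoincare4.Theorems.SymplecticOrigamiOrigamiFoldExistenceStubCleanOnePleatIroningRadial
import Summits.SmoothPoincare4.SmoothPoincare4.Theses.EuclideanOrigami
import Summits.SmoothPoincare4.SmoothPoincare4.Theses.SymplecticOrigami
import Literature.Topology.FourManifolds.SmoothTwoDiscCover
import Literature.Topology.FourManifolds.SchoenfliesBallForm
import Literature.Topology.FourManifolds.HomotopyBallSliceSphereProofs
import Literature.Topology.FourManifolds.GluckTwistProofs

/-!
# Stub `stub_outerCleanRecognition` of line `shadow-pleats` for crux `OrigamiFoldExistence` — I (GLUE):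
# the Schoenflies/Cerf glue kernel-checked and the ONE remaining ingredient named
(item stmt-SmoothPoincare4-7844, route route-SmoothPoincare4-SymplecticOrigami; line lead seat c3, S4'' worker, wave 2)

The registered stub S4'' of skeleton r5 (`Cruxes/OrigamiFoldExistence/Lines/shadow_pleats.lean`),
`stub_outerCleanRecognition : EuclideanOrigami.Schoenflies → SymplecticOrigami.CerfGammaFour → ∀ M (homotopy
4-sphere), HasOuterCleanPleatedPosition M 1 → Nonempty (M ≃ₘ S⁴)` (vocabulary `…ShadowPleatsOuterCleanDefs.lean`;
the antecedents are the route items smooth SCHOENFLIES — open — and Cerf's `Γ₄ = 0` — formal debt —, by name), is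
TRUE ON PAPER by the lead's OUTER-CLEAN RECOGNITION THEOREM (`OuterClean-analysis-c3.md`: side lemma (O1) by the
normal degree of the regular homotopy between the two creases, structure theorem (O2), corollary (O3)); this
worker's adversarial audit of the degree bookkeeping (`work/stubs/stub_outerCleanRecognition.md` §A, evidence on
the item) CONFIRMS it at `k = 1` (all four signs re-derived, orientation-reversing chart included; no general
position needed).  Following the S5a pattern (`…StubCleanOnePleatIroningDeletion`: ONE named `Prop` + a
kernel-checked reduction) and over the S5a toolkit (`…StubCleanOnePleatIroningRadial`: the crease maps
`radialSphere (proj5 ∘ ι ∘ e 0) r : S³ ↪ ℝ⁴` are smooth embeddings wherever the chart shadow is injective on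
`S_r`, fold radii included — fold kernels are transverse, `…FoldKernel`), this file proves:
* `isSmoothEmbedding_liftedCrease` — the OUTER CREASE of an outer-clean chart, lifted to the round sphere by
  `liftS4 = σ_N⁻¹` (inverse stereographic projection from the north pole), is a smooth `S³ ↪ S⁴`;
* `eq_compl_of_frontier` — the SIDE ARGUMENT (point-set): a closed ball `K = A ⊔ frontier U` missing a point of
  the open connected `U` with connected exterior IS `Uᶜ`;
* `nonempty_diffeomorph_of_chartComplement` — the GLUE: chart `e₀`, lifted crease bounding `U`, and a smooth
  `Φ : S⁴ → M` inverting the structure map on `S⁴ ∖ U` ⟹ [SCHOENFLIES in ball form on the far side of a point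
  of `U` (tree `SmoothSchoenfliesConjectureFour.exists_ball_not_mem`, from the route item by `rfl`); side
  argument: the Schoenflies ball `E` has `E(B̄⁴) = S⁴ ∖ U`; `e₀ ∘ (2·)` and `Φ ∘ E` form a `SmoothTwoDiscCover 3 M`
  (tree), a twisted sphere; CERF (route item ≡ `cerf_twistedSphere_four`)] ⟹ `M ≅ S⁴`;
* `OuterCleanRecognitionChart : Prop` — the ONE remaining ingredient, (O1)+(O2) in the form the glue consumes.
File II (`…StubOuterCleanRecognition.lean`, over `…ShadowPleatsOuterCleanDefs`) is the 15-line reduction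
`outerCleanRecognition_of_chart : OuterCleanRecognitionChart → (the registered statement, verbatim)`; here the
outer-cleanness hypothesis `IsOuterCleanPleat ι (e 0)` of that vocabulary file is spelled as the `Set.InjOn` it
unfolds to (definitionally), so that this file does not wait for it.
NOT here: a proof of `OuterCleanRecognitionChart` (Lean XL: Hopf's `deg Gauss(∂W) = χ(W)` in `ℝ⁴`, Alexander
duality, degree theory for proper maps, Whitney fold collars, seam smoothing — none in Mathlib).

Sources: the lead's `OuterClean-analysis-c3.md` §§2–4; R. Kirby, *The Topology of 4-Manifolds* (1989) Ch. I §6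
(Schoenflies, ball form); J. Cerf, LNM 53 (1968) (`Γ₄ = 0`); M. Kervaire – J. Milnor, Ann. Math. 77 (1963) §1
(twisted spheres); M. W. Hirsch, *Differential Topology* (1976) Ch. 1 §3 Thm. 3.1.
-/

noncomputable section

-- the prescribed namespace `Summit.<P>.<Sub>.…` duplicates `SmoothPoincare4` (P = Sub)
set_option linter.dupNamespace false

open scoped Manifold ContDiff Topology RealInnerProductSpace
open Set Function Metric ContinuousMap

namespace Summit.SmoothPoincare4.SmoothPoincare4.Theorems.OrigamiFoldExistence.ShadowPleats

/-! ### The lift `λ = σ_N⁻¹ : ℝ⁴ → S⁴`, the doubling map, the lifted crease -/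

/-- The north pole `N = (0,0,0,0,1)` of the round `S⁴ ⊂ ℝ⁵`. -/
def northPole : Metric.sphere (0 : EuclideanSpace ℝ (Fin 5)) 1 :=
  ⟨EuclideanSpace.single (4 : Fin 5) (1 : ℝ), by simp⟩

/-- The LIFT `λ := σ_N⁻¹ : ℝ⁴ → S⁴` of the shadow space into the round sphere: Mathlib's inverse
stereographic projection from the north pole (a smooth embedding onto `S⁴ ∖ {N}`). -/
def liftS4 : EuclideanSpace ℝ (Fin 4) → Metric.sphere (0 : EuclideanSpace ℝ (Fin 5)) 1 :=
  (stereographic' 4 northPole).symm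

/-- `λ` is injective. -/
theorem liftS4_injective : Injective liftS4 :=
  Literature.Topology.FourManifolds.stereographic'_symm_injective northPole

/-- `λ` is smooth. -/
theorem contMDiff_liftS4 : ContMDiff (𝓡 4) (𝓡 4) ∞ liftS4 :=
  Literature.Topology.FourManifolds.contMDiff_stereographic'_symm northPole

/-- `λ` is an immersion. -/
theorem injective_mfderiv_liftS4 (x : EuclideanSpace ℝ (Fin 4)) :
    Injective (mfderiv (𝓡 4) (𝓡 4) liftS4 x) :=
  Literature.Topology.FourManifolds.injective_mfderiv_stereographic'_symm northPole x

/-- The DOUBLING map `u ↦ 2u` of `ℝ⁴` (carries the unit sphere onto the outer fold sphere `S(0,2)`). -/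
def twoL : EuclideanSpace ℝ (Fin 4) →L[ℝ] EuclideanSpace ℝ (Fin 4) :=
  (2 : ℝ) • ContinuousLinearMap.id ℝ (EuclideanSpace ℝ (Fin 4))

/-- `twoL u = 2u`. -/
@[simp] theorem twoL_apply (u : EuclideanSpace ℝ (Fin 4)) : twoL u = (2 : ℝ) • u := rfl

/-- Doubling is injective. -/
theorem twoL_injective : Injective twoL := fun _ _ h =>
  smul_right_injective (EuclideanSpace ℝ (Fin 4)) (two_ne_zero (α := ℝ)) h

/-- `‖2u‖ = 2‖u‖`. -/
theorem norm_twoL (u : EuclideanSpace ℝ (Fin 4)) : ‖twoL u‖ = 2 * ‖u‖ := by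
  rw [twoL_apply, norm_smul, Real.norm_ofNat]

/-- Doubling carries the unit sphere onto the outer fold sphere `S(0,2)`. -/
theorem image_twoL_sphere : twoL '' Metric.sphere (0 : EuclideanSpace ℝ (Fin 4)) 1 = Metric.sphere 0 2 := by
  rw [show (⇑twoL : EuclideanSpace ℝ (Fin 4) → _) = fun u => (2 : ℝ) • u from rfl, image_smul,
    smul_sphere' two_ne_zero, smul_zero, Real.norm_ofNat, mul_one]

/-- Doubling carries the closed unit ball onto the closed chart ball `B̄₂`. -/
theorem image_twoL_closedBall :
    twoL '' Metric.closedBall (0 : EuclideanSpace ℝ (Fin 4)) 1 = Metric.closedBall 0 2 := by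
  rw [show (⇑twoL : EuclideanSpace ℝ (Fin 4) → _) = fun u => (2 : ℝ) • u from rfl, image_smul,
    smul_closedBall' two_ne_zero, smul_zero, Real.norm_ofNat, mul_one]

section Crease

variable {M : Type} [TopologicalSpace M] [ChartedSpace (EuclideanSpace ℝ (Fin 4)) M]
  {ι : M → EuclideanSpace ℝ (Fin 5)} {δ : ℝ} {e : Fin 1 → EuclideanSpace ℝ (Fin 4) → M}

/-- The LIFTED OUTER CREASE `θ ↦ λ(proj5 ι e₀(2θ)) : S³ → S⁴` of the chart `e₀` (the S5a stage map
`radialSphere (proj5 ∘ ι ∘ e₀) 2`, lifted). -/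
def liftedCrease (ι : M → EuclideanSpace ℝ (Fin 5)) (e₀ : EuclideanSpace ℝ (Fin 4) → M) :
    Metric.sphere (0 : EuclideanSpace ℝ (Fin 4)) 1 → Metric.sphere (0 : EuclideanSpace ℝ (Fin 5)) 1 :=
  liftS4 ∘ radialSphere (proj5 ∘ ι ∘ e₀) 2

/-- **The lifted outer crease of an OUTER-CLEAN chart (`IsOuterCleanPleat ι (e 0)` of
`…ShadowPleatsOuterCleanDefs`, definitionally the hypothesis: the chart shadow is injective on `S(0,2)`) is a
smooth embedding `S³ ↪ S⁴`**: `radialSphere (proj5 ∘ ι ∘ e 0) 2` is a smooth embedding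
`S³ ↪ ℝ⁴` (S5a toolkit: injective by outer-cleanness, immersive because fold kernels are transverse to the
fold sphere, `chartShadow_kernel`), `λ` is an injective immersion, and `S³` is compact (Hirsch's criterion
`isSmoothEmbedding_of_injective_of_injective_mfderiv`). [folklore] -/
theorem isSmoothEmbedding_liftedCrease (h : IsPleatedPosition ι δ e)
    (hclean : Set.InjOn (proj5 ∘ ι ∘ e 0) (Metric.sphere 0 2)) :
    Manifold.IsSmoothEmbedding (𝓡 3) (𝓡 4) ∞ (liftedCrease ι (e 0)) := by
  have hG := contDiff_chartShadow h
  have hc : Manifold.IsSmoothEmbedding (𝓡 3) (𝓡 4) ∞ (radialSphere (proj5 ∘ ι ∘ e 0) 2) :=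
    isSmoothEmbedding_radialSphere hG two_pos hclean fun u w _ huw hw => chartShadow_kernel h u w huw hw
  refine Literature.Topology.FourManifolds.isSmoothEmbedding_of_injective_of_injective_mfderiv
    (contMDiff_liftS4.comp hc.contMDiff) (by simp) (liftS4_injective.comp hc.isEmbedding.injective)
    fun z => ?_
  have h1 : HasMFDerivAt (𝓡 3) (𝓡 4) (radialSphere (proj5 ∘ ι ∘ e 0) 2) z
      (mfderiv (𝓡 3) (𝓡 4) (radialSphere (proj5 ∘ ι ∘ e 0) 2) z) :=
    ((hc.contMDiff z).mdifferentiableAt (by simp)).hasMFDerivAt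
  have h2 : HasMFDerivAt (𝓡 4) (𝓡 4) liftS4 (radialSphere (proj5 ∘ ι ∘ e 0) 2 z)
      (mfderiv (𝓡 4) (𝓡 4) liftS4 (radialSphere (proj5 ∘ ι ∘ e 0) 2 z)) :=
    ((contMDiff_liftS4 _).mdifferentiableAt (by simp)).hasMFDerivAt
  rw [liftedCrease, (h2.comp z h1).mfderiv]
  intro a b hab
  exact Literature.Topology.FourManifolds.injective_mfderiv_of_isImmersionAt' (hc.isImmersion.isImmersionAt z)
    (injective_mfderiv_liftS4 _ hab)

end Crease

/-! ### The side argument (point-set topology) -/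

/-- **SIDE ARGUMENT.** In a topological space let `U` be open and preconnected with preconnected
exterior `(closure U)ᶜ`, and let `K = A ∪ frontier U` be closed with `A` open, preconnected,
non-empty and disjoint from `frontier U` (think: `K = E(B̄)`, `A = E(B)` for a ball `E` bounded by
the sphere `frontier U`).  If `K` misses a point of `U`, then `K = Uᶜ`.  (The complement of the
sphere is `U ⊔ (closure U)ᶜ = A ⊔ Kᶜ`; compare the pieces.) [folklore] -/
theorem eq_compl_of_frontier {X : Type*} [TopologicalSpace X] {U A K : Set X} {p : X}
    (hU : IsOpen U) (hUc : IsPreconnected U) (hXc : IsPreconnected (closure U)ᶜ)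
    (hAc : IsPreconnected A) (hAne : A.Nonempty) (hAo : IsOpen A) (hK : IsClosed K)
    (hKA : K = A ∪ frontier U) (hAfr : Disjoint A (frontier U)) (hpU : p ∈ U) (hpK : p ∉ K) :
    K = Uᶜ := by
  have hfr : frontier U = closure U \ U := hU.frontier_eq
  have hAK : A ⊆ K := hKA ▸ subset_union_left
  have hUfr : Disjoint U (frontier U) := Set.disjoint_iff_inter_eq_empty.2 hU.inter_frontier_eq
  -- the two decompositions `U ⊔ (closure U)ᶜ = A ⊔ Kᶜ` of the complement of the sphere `frontier U`
  have hA_sub : A ⊆ U ∪ (closure U)ᶜ := fun x hx => by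
    by_cases hxc : x ∈ closure U
    · refine Or.inl (by_contra fun hxU => ?_)
      exact Set.disjoint_left.1 hAfr hx (by rw [hfr]; exact ⟨hxc, hxU⟩)
    · exact Or.inr hxc
  have hsub : ∀ x, x ∉ frontier U → x ∈ A ∪ Kᶜ := fun x hx => by
    by_cases hxK : x ∈ K
    · rw [hKA] at hxK
      exact hxK.elim Or.inl fun hxf => absurd hxf hx
    · exact Or.inr hxK
  have hU_sub : U ⊆ A ∪ Kᶜ := fun x hx => hsub x (Set.disjoint_left.1 hUfr hx)
  have hX_sub : (closure U)ᶜ ⊆ A ∪ Kᶜ := fun x hx => hsub x fun hxf => hx (hfr ▸ hxf).1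
  have hdisj₁ : Disjoint U (closure U)ᶜ := Set.disjoint_compl_right_iff_subset.2 subset_closure
  have hdisj₂ : Disjoint A Kᶜ := Set.disjoint_compl_right_iff_subset.2 hAK
  obtain ⟨a, ha⟩ := hAne
  -- `U ⊆ Kᶜ` (it contains `p ∉ K`), hence `A ⊆ (closure U)ᶜ`, hence `(closure U)ᶜ ⊆ A`
  have hUK : U ⊆ Kᶜ := (hUc.subset_or_subset hAo hK.isOpen_compl hdisj₂ hU_sub).resolve_left
    fun h => hpK (hAK (h hpU))
  have hAX : A ⊆ (closure U)ᶜ :=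
    (hAc.subset_or_subset hU isClosed_closure.isOpen_compl hdisj₁ hA_sub).resolve_left
      fun h => hUK (h ha) (hAK ha)
  have hXA : (closure U)ᶜ ⊆ A := (hXc.subset_or_subset hAo hK.isOpen_compl hdisj₂ hX_sub).resolve_right
    fun h => h (hAX ha) (hAK ha)
  rw [hKA, subset_antisymm hAX hXA, hfr]
  ext x
  simp only [mem_union, mem_compl_iff, mem_sdiff]
  constructor
  · rintro (hx | ⟨-, hx⟩)
    · exact fun hxU => hx (subset_closure hxU)
    · exact hx
  · exact fun hx => (em (x ∈ closure U)).elim (fun hxc => Or.inr ⟨hxc, hx⟩) Or.inl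

/-! ### The glue: chart-complement structure + Schoenflies + Cerf `Γ₄ = 0` ⇒ `M ≅ S⁴` -/

section Glue

variable {M : Type} [TopologicalSpace M] [T2Space M] [SecondCountableTopology M]
  [ChartedSpace (EuclideanSpace ℝ (Fin 4)) M] [IsManifold (𝓡 4) ∞ M]

omit [T2Space M] [SecondCountableTopology M] [IsManifold (𝓡 4) ∞ M] in
/-- The rescaled chart `e₀ ∘ (2·)` is an immersion. -/
theorem injective_mfderiv_comp_twoL {e₀ : EuclideanSpace ℝ (Fin 4) → M}
    (he : Manifold.IsSmoothEmbedding (𝓡 4) (𝓡 4) ∞ e₀) (y : EuclideanSpace ℝ (Fin 4)) :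
    Injective (mfderiv (𝓡 4) (𝓡 4) (e₀ ∘ ⇑twoL) y) := by
  have h2 : HasMFDerivAt 𝓘(ℝ, EuclideanSpace ℝ (Fin 4)) (𝓡 4) e₀ (twoL y)
      (mfderiv (𝓡 4) (𝓡 4) e₀ (twoL y)) :=
    ((he.contMDiff _).mdifferentiableAt (by simp)).hasMFDerivAt
  rw [(h2.comp y twoL.hasMFDerivAt).mfderiv]
  intro a b hab
  exact twoL_injective ((Literature.Topology.FourManifolds.injective_mfderiv_of_isImmersionAt'
    (he.isImmersion.isImmersionAt _)) hab)

/-- **GLUE.**  Let `e₀ : ℝ⁴ ↪ M` be a chart of the `4`-manifold `M`, `c : ℝ⁴ → S⁴` a map whose rescaled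
restriction `θ ↦ c(2θ)` to the unit sphere is a smooth embedding `S³ ↪ S⁴` with image the frontier of an
open connected `U ⊆ S⁴` with connected exterior, and `Φ : S⁴ → M` smooth, an injective immersion on `S⁴ ∖ U`
with image the FAKE BALL `M ∖ e₀(B₂)`, inverting `c` on `S(0,2)` (`Φ (c u) = e₀ u`).  Then, GIVEN smooth
Schoenflies (route item `EuclideanOrigami.Schoenflies` ≡ `SmoothSchoenfliesConjectureFour`, used in ball form on
the far side of a point of `U`: tree `SmoothSchoenfliesConjectureFour.exists_ball_not_mem`) and Cerf's `Γ₄ = 0`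
(route item `SymplecticOrigami.CerfGammaFour` ≡ `cerf_twistedSphere_four`), `M ≅ S⁴`: the Schoenflies ball
`E : ℝ⁴ ↪ S⁴` bounded by the crease sphere has `E(B̄⁴) = S⁴ ∖ U` (`eq_compl_of_frontier`), so `e₀ ∘ (2·)` and
`Φ ∘ E` form a two-disc cover of `M` (tree `SmoothTwoDiscCover`), a twisted sphere, and Cerf concludes
(`SmoothTwoDiscCover.nonempty_diffeomorph_sphere_four`). [folklore] -/
theorem nonempty_diffeomorph_of_chartComplement
    (hS : Summit.SmoothPoincare4.SmoothPoincare4.Theses.EuclideanOrigami.Schoenflies)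
    (hC : Summit.SmoothPoincare4.SmoothPoincare4.Theses.SymplecticOrigami.CerfGammaFour)
    {e₀ : EuclideanSpace ℝ (Fin 4) → M} (he : Manifold.IsSmoothEmbedding (𝓡 4) (𝓡 4) ∞ e₀)
    {c : EuclideanSpace ℝ (Fin 4) → Metric.sphere (0 : EuclideanSpace ℝ (Fin 5)) 1}
    (hf : Manifold.IsSmoothEmbedding (𝓡 3) (𝓡 4) ∞
      (fun z : Metric.sphere (0 : EuclideanSpace ℝ (Fin 4)) 1 => c ((2 : ℝ) • (z : EuclideanSpace ℝ (Fin 4)))))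
    {Φ : Metric.sphere (0 : EuclideanSpace ℝ (Fin 5)) 1 → M}
    {U : Set (Metric.sphere (0 : EuclideanSpace ℝ (Fin 5)) 1)}
    (hUo : IsOpen U) (hUc : IsConnected U) (hXc : IsConnected (closure U)ᶜ)
    (hfr : frontier U = c '' Metric.sphere 0 2)
    (hΦ : ContMDiff (𝓡 4) (𝓡 4) ∞ Φ) (hΦi : InjOn Φ Uᶜ)
    (hΦd : ∀ x ∈ Uᶜ, Injective (mfderiv (𝓡 4) (𝓡 4) Φ x))
    (hΦU : Φ '' Uᶜ = (e₀ '' Metric.ball 0 2)ᶜ)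
    (hΦc : ∀ u ∈ Metric.sphere (0 : EuclideanSpace ℝ (Fin 4)) 2, Φ (c u) = e₀ u) :
    Nonempty (M ≃ₘ⟮𝓡 4, 𝓡 4⟯ (Metric.sphere (0 : EuclideanSpace ℝ (Fin 5)) 1)) := by
  set f : Metric.sphere (0 : EuclideanSpace ℝ (Fin 4)) 1 → Metric.sphere (0 : EuclideanSpace ℝ (Fin 5)) 1 :=
    fun z => c ((2 : ℝ) • (z : EuclideanSpace ℝ (Fin 4))) with hf_def
  have hrange : range f = c '' Metric.sphere 0 2 := by
    rw [show f = c ∘ ⇑twoL ∘ Subtype.val from rfl, range_comp, range_comp, Subtype.range_coe,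
      image_twoL_sphere]
  -- the crease sphere `C = frontier U` misses `U`
  have hCU : Disjoint U (frontier U) := Set.disjoint_iff_inter_eq_empty.2 hUo.inter_frontier_eq
  obtain ⟨p, hpU⟩ := hUc.nonempty
  have hp : p ∉ range f := by
    rw [hrange, ← hfr]
    exact Set.disjoint_left.1 hCU hpU
  -- SCHOENFLIES, ball form on the far side of `p`
  have hS' : Summit.SmoothPoincare4.SmoothPoincare4.SmoothSchoenfliesConjectureFour := hS
  obtain ⟨E, hE, hEs, hpE⟩ :=
    Literature.Topology.FourManifolds.SmoothSchoenfliesConjectureFour.exists_ball_not_mem hS' f hf p hp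
  have hEc : Continuous E := hE.contMDiff.continuous
  have hEinj : Injective E := hE.isEmbedding.injective
  have hEo : IsOpenMap E :=
    Literature.Topology.FourManifolds.Manifold.IsSmoothEmbedding.isOpenMap_of_finrank_eq hE rfl
  have hEd : ∀ y, Injective (mfderiv (𝓡 4) (𝓡 4) E y) := fun y =>
    Literature.Topology.FourManifolds.injective_mfderiv_of_isImmersionAt' (hE.isImmersion.isImmersionAt y)
  -- the SIDE ARGUMENT: `E(B̄) = S⁴ ∖ U`
  have hK : E '' Metric.closedBall 0 1 = Uᶜ := by
    refine eq_compl_of_frontier (A := E '' Metric.ball 0 1) hUo hUc.isPreconnected hXc.isPreconnected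
      ((convex_ball (0 : EuclideanSpace ℝ (Fin 4)) 1).isPreconnected.image E hEc.continuousOn)
      ⟨E 0, mem_image_of_mem E (mem_ball_self one_pos)⟩ (hEo _ isOpen_ball)
      ((isCompact_closedBall (0 : EuclideanSpace ℝ (Fin 4)) 1).image hEc).isClosed ?_ ?_ hpU hpE
    · rw [hfr, ← hrange, ← hEs, ← image_union, ball_union_sphere]
    · rw [hfr, ← hrange, ← hEs]
      exact (Set.disjoint_image_iff hEinj).2 (Set.disjoint_left.2 fun x hx hx' => by
        rw [mem_ball_zero_iff] at hx
        rw [mem_sphere_zero_iff_norm] at hx'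
        linarith)
  have hKs : E '' Metric.sphere 0 1 = c '' Metric.sphere 0 2 := by rw [hEs, hrange]
  have hEU : ∀ y ∈ Metric.closedBall (0 : EuclideanSpace ℝ (Fin 4)) 1, E y ∈ Uᶜ := fun y hy => by
    rw [← hK]
    exact mem_image_of_mem E hy
  -- the TWO-DISC COVER of `M`: the chart ball and the fake ball
  let T : Literature.Topology.FourManifolds.SmoothTwoDiscCover 3 M :=
    { FA := e₀ ∘ ⇑twoL
      FB := Φ ∘ E
      contMDiff_FA := he.contMDiff.comp twoL.contMDiff
      contMDiff_FB := hΦ.comp hE.contMDiff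
      injOn_FA := (he.isEmbedding.injective.comp twoL_injective).injOn
      injOn_FB := fun a ha b hb hab => hEinj (hΦi (hEU a ha) (hEU b hb) hab)
      injective_mfderiv_FA := fun y _ => injective_mfderiv_comp_twoL he y
      injective_mfderiv_FB := by
        intro y hy
        have h1 : HasMFDerivAt (𝓡 4) (𝓡 4) E y (mfderiv (𝓡 4) (𝓡 4) E y) :=
          ((hE.contMDiff y).mdifferentiableAt (by simp)).hasMFDerivAt
        have h2 : HasMFDerivAt (𝓡 4) (𝓡 4) Φ (E y) (mfderiv (𝓡 4) (𝓡 4) Φ (E y)) :=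
          ((hΦ _).mdifferentiableAt (by simp)).hasMFDerivAt
        rw [(h2.comp y h1).mfderiv]
        intro a b hab
        exact hEd y (hΦd _ (hEU y hy) hab)
      union_eq := by
        rw [image_comp, image_twoL_closedBall, image_comp, hK, hΦU]
        refine eq_univ_of_forall fun m => ?_
        by_cases hm : m ∈ e₀ '' Metric.ball 0 2
        · obtain ⟨u, hu, rfl⟩ := hm
          exact Or.inl (mem_image_of_mem e₀ (ball_subset_closedBall hu))
        · exact Or.inr hm
      norm_eq_one_of_eq := by
        intro a ha b hb hab
        have hab' : e₀ (twoL a) = Φ (E b) := hab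
        -- `e₀ (2a) = Φ (E b) ∉ e₀(B₂)`, so `‖a‖ = 1`
        have hFb : Φ (E b) ∈ (e₀ '' Metric.ball 0 2)ᶜ := hΦU ▸ mem_image_of_mem Φ (hEU b hb)
        have ha1 : ‖a‖ = 1 := by
          have hnot : twoL a ∉ Metric.ball (0 : EuclideanSpace ℝ (Fin 4)) 2 := fun hin =>
            hFb (hab' ▸ mem_image_of_mem e₀ hin)
          rw [mem_ball_zero_iff, norm_twoL, not_lt] at hnot
          rw [mem_closedBall_zero_iff] at ha
          linarith
        refine ⟨ha1, ?_⟩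
        -- `E b = c (2a) ∈ E(S³)`, so `‖b‖ = 1`
        have ha2 : twoL a ∈ Metric.sphere (0 : EuclideanSpace ℝ (Fin 4)) 2 := by
          rw [mem_sphere_zero_iff_norm, norm_twoL, ha1, mul_one]
        have hca : c (twoL a) ∈ Uᶜ := fun hU =>
          Set.disjoint_left.1 hCU hU (hfr ▸ mem_image_of_mem c ha2 : c (twoL a) ∈ frontier U)
        have hEb : E b = c (twoL a) := by
          apply hΦi (hEU b hb) hca
          rw [hΦc _ ha2]
          exact hab'.symm
        obtain ⟨s, hs, hsb⟩ : E b ∈ E '' Metric.sphere 0 1 := hKs ▸ hEb ▸ mem_image_of_mem c ha2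
        rw [← hEinj hsb]
        exact mem_sphere_zero_iff_norm.1 hs
      image_sphere_eq := by
        rw [image_comp, image_twoL_sphere, image_comp, hKs, ← image_comp]
        exact (image_congr fun u hu => hΦc u hu).symm }
  exact Literature.Topology.FourManifolds.SmoothTwoDiscCover.nonempty_diffeomorph_sphere_four hC T

end Glue

/-! ### The ONE remaining ingredient -/

/-- **OUTER-CLEAN RECOGNITION CHART — the single geometric ingredient of S4''** (`Prop` over the line
vocabulary; TRUE ON PAPER = the lead's side lemma (O1) + structure theorem (O2) of
`Cruxes/OrigamiFoldExistence/OuterClean-analysis-c3.md` §§2–3, audited in `work/stubs/stub_outerCleanRecognition.md`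
§A; NOT PROVED HERE — Lean cost: Hopf's Umlaufsatz `deg Gauss(∂W) = χ(W)` in `ℝ⁴`, Alexander duality for the
crease sphere, degree theory for the proper shadow `proj5 ι|P̄⁺`, Whitney fold collars and a seam smoothing).
CONTENT.  For a homotopy `4`-sphere `M` in a `1`-chart pleated round-rim position `(ι, δ, e)` whose chart is
OUTER-CLEAN (`IsOuterCleanPleat ι (e 0)`, spelled as the `Set.InjOn` it unfolds to: the outer crease
`c_out = proj5 ι e₀(S(0,2))` is an embedded `S³ ⊂ ℝ⁴`), with `λ = liftS4`: there are
an open `U ⊆ S⁴` (the lifted CHIMNEY `λ(U_out)`, `U_out` the bounded component of `ℝ⁴ ∖ c_out`) and a smooth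
`Φ : S⁴ → M` such that `U` is connected with connected exterior `(closure U)ᶜ = λ(ℝ⁴ ∖ Ū_out) ∪ {N}` and
`frontier U = λ(c_out)` (Jordan–Brouwer), and `Φ|_{S⁴ ∖ U}` is an injective immersion ONTO the fake ball
`M ∖ e₀(B₂)` with `Φ (λ (proj5 ι e₀ u)) = e₀ u` on `S(0,2)` — i.e. `Φ|_{S⁴∖U}` inverts (O2)(d)'s diffeomorphism
`M ∖ e₀(B₂) ≅ S⁴ ∖ λ(U_out)` (the outer sheet `P̄⁺` is shadow-EMBEDDED onto `B̄ ∖ U_out` because, by (O1), the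
two germs born at `c_out` lie OUTSIDE `U_out`, whence `n_P = 1_B − 1_{U_out}`; the lower hemisphere closes it
up), extended across a collar and by a cutoff into the chart over `U`.  No Schoenflies, no Cerf: those are
consumed by the glue `nonempty_diffeomorph_of_chartComplement` (file II: `outerCleanRecognition_of_chart`). -/
def OuterCleanRecognitionChart : Prop :=
  ∀ (M : Type) [TopologicalSpace M] [T2Space M] [SecondCountableTopology M]
    [ChartedSpace (EuclideanSpace ℝ (Fin 4)) M] [IsManifold (𝓡 4) ∞ M],
    M ≃ₕ (Metric.sphere (0 : EuclideanSpace ℝ (Fin 5)) 1) →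
    ∀ (ι : M → EuclideanSpace ℝ (Fin 5)) (δ : ℝ) (e : Fin 1 → EuclideanSpace ℝ (Fin 4) → M),
      IsPleatedPosition ι δ e → Set.InjOn (proj5 ∘ ι ∘ e 0) (Metric.sphere 0 2) →
      ∃ (Φ : Metric.sphere (0 : EuclideanSpace ℝ (Fin 5)) 1 → M)
        (U : Set (Metric.sphere (0 : EuclideanSpace ℝ (Fin 5)) 1)),
        IsOpen U ∧ IsConnected U ∧ IsConnected (closure U)ᶜ ∧
        frontier U = (liftS4 ∘ proj5 ∘ ι ∘ e 0) '' Metric.sphere 0 2 ∧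
        ContMDiff (𝓡 4) (𝓡 4) ∞ Φ ∧ Set.InjOn Φ Uᶜ ∧
        (∀ x ∈ Uᶜ, Function.Injective (mfderiv (𝓡 4) (𝓡 4) Φ x)) ∧
        Φ '' Uᶜ = (e 0 '' Metric.ball 0 2)ᶜ ∧
        ∀ u ∈ Metric.sphere (0 : EuclideanSpace ℝ (Fin 4)) 2, Φ (liftS4 (proj5 (ι (e 0 u)))) = e 0 u

end Summit.SmoothPoincare4.SmoothPoincare4.Theorems.OrigamiFoldExistence.ShadowPleats

end
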